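import Summits.CriticalPhenomena.PercolationContinuityZ3.Theorems.PercNearOneGluingNoHeavyLowerTailThreePointProductFormFibreForestSkeleton
import HarnessLib

/-!
# The forest form of the halving lemma, IV: THEOREM A — the forest form on the contractions gives `#bad ≤ #P1 + #P2`
# (Sahi programme, prover prim-sahi-p2 gen 58)

Support file (`--supports stmt-CriticalPhenomena-4575`, helper); continues `…ProductFormFibreForestSkeleton` (same gen).  Standard axioms, no sorries,
no named facts, no definitions.  Memos `run/shared/lean/prim/prim-sahi/FROM-prim-sahi-p2-gen57-FOREST-FORM.md` §2 (Theorem A) and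
`…/FROM-prim-sahi-p2-gen58-*.md` §3.

For a finite labelled multigraph `H = (V, α, ends)` and vertices `a, s, c`, with `R z x y := (openGraph (labelledOpen ends z)).Reachable x y`,
`bad = {z : ¬R z a s, ¬R z a c, ¬R z s c, R (♭z) s c}` (`♭z = clusterFlip ends a z̄`), `P1 = {R z a s ∧ ¬R z a c}`, `P2 = {R z a c ∧ ¬R z a s}`.
For `zN : α → Bool` the CONTRACTION `H/zN` is the labelled multigraph with vertices the connected components of `openGraph (labelledOpen ends zN)`,
labels `{l // zN l = false}` and endpoints `l ↦ (ends l).map connectedComponentMk`; a FOREST configuration is one in which every open label joins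
two distinct vertices and separates them once closed.
* `card_filter_eq_sum_skeleton` [this work] — every count of configurations splits along the skeleton classes (each configuration lies in
  exactly one class, that of its open non-bridges).
* `card_bad_skeleton_le`, `card_forest_sa_quotient_le` [this work] — on a skeleton class, restriction to the non-skeleton labels injects the bad
  configurations into the bad FORESTS of `H/zN`, and extension by the skeleton injects the P1- (P2-) forests of `H/zN` into the P1- (P2-)
  configurations of the class (`…ForestSkeleton`).
* **`card_bad_le_of_forestForm_contractions`** [this work] — THEOREM A: if the forest form (FOR) `#bad forests ≤ #P1 forests + #P2 forests` holds
  on every contraction `H/zN` of `H` (with apex and terminals the contracted vertices of `a, s, c`), then `#bad ≤ #P1 + #P2` on `H` — the fibre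
  inequality FIB-v which, fibre by fibre, gives the halving lemma (v) `μ(U)μ(D) ≤ 2μ(U∩D)` (gen 43/57 memos).  (FOR) itself is a conjecture
  (0 violations on every multigraph with ≤ 7 vertices and every simple graph with ≤ 9 vertices, gen 58 census); this file is the reduction only.
[folklore] (fibrewise counting); [cite: Gladkov2024, Conjecture 10.1 (p. 18), arXiv:2408.08457] for the conjectures served.
-/

namespace Summit.CriticalPhenomena.PercolationContinuityZ3.Theorems.ProductFormFibre

open Finset Literature.Probability.Percolation
open Summit.CriticalPhenomena.PercolationContinuityZ3.Theorems.ThreePointCPIClusterSwap (clusterFlip)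

variable {V α : Type*}

section ForestFormToFibre

variable (ends : α → Sym2 V)

/-! ### 1. Comparison of a skeleton class with the forests of the contraction -/

section Counting

variable [Fintype V] [DecidableEq V] [Fintype α] [DecidableEq α] (a s c : V)

open Classical in
/-- **Bad members of a skeleton class inject into the bad forests of the contraction** (restriction to the non-skeleton labels). [this work] -/
theorem card_bad_skeleton_le (zN : α → Bool) :
    (univ.filter fun z : α → Bool =>
        ((∀ l, zN l = true → z l = true ∧
            ∀ x y, ends l = s(x, y) → (openGraph (labelledOpen ends (Function.update z l false))).Reachable x y) ∧
          (∀ l, zN l = false → z l = true →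
            ∀ x y, ends l = s(x, y) → ¬ (openGraph (labelledOpen ends (Function.update z l false))).Reachable x y)) ∧
        (¬ (openGraph (labelledOpen ends z)).Reachable a s ∧ ¬ (openGraph (labelledOpen ends z)).Reachable a c ∧
          ¬ (openGraph (labelledOpen ends z)).Reachable s c) ∧
        (openGraph (labelledOpen ends (clusterFlip ends a fun l => !z l))).Reachable s c).card ≤
    (univ.filter fun z' : {l // zN l = false} → Bool =>
        (∀ b, z' b = true → ∀ X Y,
          (fun l : {l // zN l = false} => (ends l.1).map (openGraph (labelledOpen ends zN)).connectedComponentMk) b = s(X, Y) →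
            X ≠ Y ∧ ¬ (openGraph (labelledOpen
              (fun l : {l // zN l = false} => (ends l.1).map (openGraph (labelledOpen ends zN)).connectedComponentMk)
              (Function.update z' b false))).Reachable X Y) ∧
        (¬ (openGraph (labelledOpen
              (fun l : {l // zN l = false} => (ends l.1).map (openGraph (labelledOpen ends zN)).connectedComponentMk) z')).Reachable
              ((openGraph (labelledOpen ends zN)).connectedComponentMk a) ((openGraph (labelledOpen ends zN)).connectedComponentMk s) ∧
          ¬ (openGraph (labelledOpen
              (fun l : {l // zN l = false} => (ends l.1).map (openGraph (labelledOpen ends zN)).connectedComponentMk) z')).Reachable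
              ((openGraph (labelledOpen ends zN)).connectedComponentMk a) ((openGraph (labelledOpen ends zN)).connectedComponentMk c) ∧
          ¬ (openGraph (labelledOpen
              (fun l : {l // zN l = false} => (ends l.1).map (openGraph (labelledOpen ends zN)).connectedComponentMk) z')).Reachable
              ((openGraph (labelledOpen ends zN)).connectedComponentMk s) ((openGraph (labelledOpen ends zN)).connectedComponentMk c)) ∧
        (openGraph (labelledOpen
            (fun l : {l // zN l = false} => (ends l.1).map (openGraph (labelledOpen ends zN)).connectedComponentMk)
            (clusterFlip (fun l : {l // zN l = false} => (ends l.1).map (openGraph (labelledOpen ends zN)).connectedComponentMk)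
              ((openGraph (labelledOpen ends zN)).connectedComponentMk a) (fun l => !z' l)))).Reachable
          ((openGraph (labelledOpen ends zN)).connectedComponentMk s) ((openGraph (labelledOpen ends zN)).connectedComponentMk c)).card := by
  refine Finset.card_le_card_of_injOn (fun z => fun l : {l // zN l = false} => z l.1) ?_ ?_
  · intro z hz
    rw [Finset.mem_coe, Finset.mem_filter] at hz
    obtain ⟨-, ⟨hsk, hbr⟩, ⟨hnas, hnac, hnsc⟩, hflat⟩ := hz
    have hN : ∀ l, zN l = true → z l = true := fun l hl => (hsk l hl).1
    rw [Finset.mem_coe, Finset.mem_filter]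
    refine ⟨Finset.mem_univ _, forest_restrict_of_skeleton ends z zN hN hbr, ⟨?_, ?_, ?_⟩, ?_⟩
    · exact fun h => hnas (reachable_of_reachable_quotient ends z zN hN h)
    · exact fun h => hnac (reachable_of_reachable_quotient ends z zN hN h)
    · exact fun h => hnsc (reachable_of_reachable_quotient ends z zN hN h)
    · exact reachable_flat_quotient ends z zN hN a hflat
  · intro z₁ hz₁ z₂ hz₂ h
    rw [Finset.mem_coe, Finset.mem_filter] at hz₁ hz₂
    exact eq_of_restrict_eq z₁ z₂ zN (fun l hl => (hz₁.2.1.1 l hl).1) (fun l hl => (hz₂.2.1.1 l hl).1) h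

open Classical in
/-- **The P1-forests of the contraction inject into the P1-members of a NONEMPTY skeleton class** (extension by the skeleton; the class must be
nonempty for the skeleton to be closed).  Stated for the ordered pair `(s, c)`; exchange `s` and `c` for P2. [this work] -/
theorem card_forest_sa_quotient_le (zN : α → Bool)
    (hne : ∃ z₀ : α → Bool,
      (∀ l, zN l = true → z₀ l = true ∧
          ∀ x y, ends l = s(x, y) → (openGraph (labelledOpen ends (Function.update z₀ l false))).Reachable x y) ∧
        (∀ l, zN l = false → z₀ l = true →
          ∀ x y, ends l = s(x, y) → ¬ (openGraph (labelledOpen ends (Function.update z₀ l false))).Reachable x y)) :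
    (univ.filter fun z' : {l // zN l = false} → Bool =>
        (∀ b, z' b = true → ∀ X Y,
          (fun l : {l // zN l = false} => (ends l.1).map (openGraph (labelledOpen ends zN)).connectedComponentMk) b = s(X, Y) →
            X ≠ Y ∧ ¬ (openGraph (labelledOpen
              (fun l : {l // zN l = false} => (ends l.1).map (openGraph (labelledOpen ends zN)).connectedComponentMk)
              (Function.update z' b false))).Reachable X Y) ∧
        ((openGraph (labelledOpen
              (fun l : {l // zN l = false} => (ends l.1).map (openGraph (labelledOpen ends zN)).connectedComponentMk) z')).Reachable
              ((openGraph (labelledOpen ends zN)).connectedComponentMk a) ((openGraph (labelledOpen ends zN)).connectedComponentMk s) ∧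
          ¬ (openGraph (labelledOpen
              (fun l : {l // zN l = false} => (ends l.1).map (openGraph (labelledOpen ends zN)).connectedComponentMk) z')).Reachable
              ((openGraph (labelledOpen ends zN)).connectedComponentMk a) ((openGraph (labelledOpen ends zN)).connectedComponentMk c))).card ≤
    (univ.filter fun z : α → Bool =>
        ((∀ l, zN l = true → z l = true ∧
            ∀ x y, ends l = s(x, y) → (openGraph (labelledOpen ends (Function.update z l false))).Reachable x y) ∧
          (∀ l, zN l = false → z l = true →
            ∀ x y, ends l = s(x, y) → ¬ (openGraph (labelledOpen ends (Function.update z l false))).Reachable x y)) ∧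
        ((openGraph (labelledOpen ends z)).Reachable a s ∧ ¬ (openGraph (labelledOpen ends z)).Reachable a c)).card := by
  obtain ⟨z₀, hsk₀, hbr₀⟩ := hne
  have hcl : ∀ l, zN l = true → ∀ x y, ends l = s(x, y) →
      (openGraph (labelledOpen ends (Function.update zN l false))).Reachable x y :=
    fun l hl x y hxy => skeleton_closed ends z₀ zN hsk₀ hbr₀ hl hxy
  refine Finset.card_le_card_of_injOn (fun z' => fun b => if h : zN b = false then z' ⟨b, h⟩ else true) ?_ ?_
  · intro z' hz'
    rw [Finset.mem_coe, Finset.mem_filter] at hz'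
    obtain ⟨-, hfor, has, hnac⟩ := hz'
    rw [Finset.mem_coe, Finset.mem_filter]
    have hskel := extension_skeleton ends zN hcl z'
    have hN : ∀ l, zN l = true → (fun b => if h : zN b = false then z' ⟨b, h⟩ else true) l = true := fun l hl => (hskel l hl).1
    have hrest := restrict_extension zN z'
    refine ⟨Finset.mem_univ _, ⟨hskel, extension_bridge ends zN z' hfor⟩, ?_, ?_⟩
    · refine reachable_of_reachable_quotient ends _ zN hN ?_
      rw [hrest]; exact has
    · intro h
      have h' := reachable_quotient_of_reachable ends (fun b => if h : zN b = false then z' ⟨b, h⟩ else true) zN h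
      rw [hrest] at h'
      exact hnac h'
  · intro z₁ _ z₂ _ h
    have h1 := restrict_extension zN z₁
    have h2 := restrict_extension zN z₂
    rw [← h1, ← h2]
    funext l
    exact congrFun (congrArg (fun (e : α → Bool) => fun l : {l // zN l = false} => e l.1) h) l

open Classical in
/-- **Every count splits along the skeleton classes**: each configuration lies in exactly one skeleton class, that of its open non-bridges.
[this work] -/
theorem card_filter_eq_sum_skeleton (P : (α → Bool) → Prop) [DecidablePred P] :
    (univ.filter P).card = ∑ zN : α → Bool, (univ.filter fun z : α → Bool =>
      ((∀ l, zN l = true → z l = true ∧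
          ∀ x y, ends l = s(x, y) → (openGraph (labelledOpen ends (Function.update z l false))).Reachable x y) ∧
        (∀ l, zN l = false → z l = true →
          ∀ x y, ends l = s(x, y) → ¬ (openGraph (labelledOpen ends (Function.update z l false))).Reachable x y)) ∧ P z).card := by
  set sk : (α → Bool) → (α → Bool) := fun z l => z l && decide (∀ x y, ends l = s(x, y) →
      (openGraph (labelledOpen ends (Function.update z l false))).Reachable x y) with hsk_def
  have hiff : ∀ zN z : α → Bool,
      ((∀ l, zN l = true → z l = true ∧
          ∀ x y, ends l = s(x, y) → (openGraph (labelledOpen ends (Function.update z l false))).Reachable x y) ∧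
        (∀ l, zN l = false → z l = true →
          ∀ x y, ends l = s(x, y) → ¬ (openGraph (labelledOpen ends (Function.update z l false))).Reachable x y)) ↔ sk z = zN := by
    intro zN z
    constructor
    · rintro ⟨hsk, hbr⟩
      funext l
      by_cases hl : zN l = true
      · obtain ⟨hz, hnb⟩ := hsk l hl
        rw [hl]; simp only [hsk_def, hz, Bool.true_and, decide_eq_true_eq]; exact hnb
      · have hl' : zN l = false := by simpa using hl
        rw [hl']
        by_cases hz : z l = true
        · simp only [hsk_def, hz, Bool.true_and, decide_eq_false_iff_not]
          intro hnb
          obtain ⟨⟨x, y⟩, hxy⟩ := Quot.exists_rep (ends l)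
          exact hbr l hl' hz x y hxy.symm (hnb x y hxy.symm)
        · have hz' : z l = false := by simpa using hz
          simp [hsk_def, hz']
    · rintro rfl
      constructor
      · intro l hl
        simp only [hsk_def, Bool.and_eq_true, decide_eq_true_eq] at hl
        exact hl
      · intro l hl hz x y hxy hr
        simp only [hsk_def, hz, Bool.true_and, decide_eq_false_iff_not] at hl
        apply hl
        intro x' y' hxy'
        rw [hxy] at hxy'
        rcases Sym2.eq_iff.1 hxy' with ⟨rfl, rfl⟩ | ⟨rfl, rfl⟩
        · exact hr
        · exact hr.symm
  rw [Finset.card_eq_sum_card_fiberwise (f := sk) (s := univ.filter P) (t := univ) (fun _ _ => Finset.mem_univ _)]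
  refine Finset.sum_congr rfl fun zN _ => ?_
  rw [Finset.filter_filter]
  congr 1
  ext z
  simp only [Finset.mem_filter, Finset.mem_univ, true_and]
  rw [← hiff zN z]
  exact and_comm

/-! ### 2. THEOREM A -/

/- Abbreviations used in the comments below: for `zN : α → Bool`, `GN := openGraph (labelledOpen ends zN)`, `π := GN.connectedComponentMk`,
`ends' := fun l : {l // zN l = false} => (ends l.1).map π`, `R' z' X Y := (openGraph (labelledOpen ends' z')).Reachable X Y`. -/

open Classical in
/-- **THEOREM A (the forest form on the contractions gives FIB-v).**  Let `H = (V, α, ends)` be a finite labelled multigraph and `a, s, c`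
vertices.  Suppose that for EVERY `zN : α → Bool` the contraction `H/zN` satisfies the forest form of the halving lemma:
`#{forests z' of H/zN : π a, π s, π c pairwise separated in z', π s ↔ π c in ♭z'} ≤ #{forests : π a ↔ π s, π a ↮ π c} + #{forests : π a ↔ π c, π a ↮ π s}`.
Then `#bad ≤ #P1 + #P2` on `H`:  `#{z : a ↮ s, a ↮ c, s ↮ c in z, s ↔ c in ♭z} ≤ #{z : a ↔ s, a ↮ c} + #{z : a ↔ c, a ↮ s}`.
Proof: every configuration lies in exactly one skeleton class (that of its open non-bridges); split every count along the classes; on a nonempty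
class use `card_bad_skeleton_le`, the hypothesis for that `zN`, and `card_forest_sa_quotient_le` twice. [this work] -/
theorem card_bad_le_of_forestForm_contractions
    (hFOR : ∀ zN : α → Bool,
      (univ.filter fun z' : {l // zN l = false} → Bool =>
        (∀ b, z' b = true → ∀ X Y,
          (fun l : {l // zN l = false} => (ends l.1).map (openGraph (labelledOpen ends zN)).connectedComponentMk) b = s(X, Y) →
            X ≠ Y ∧ ¬ (openGraph (labelledOpen
              (fun l : {l // zN l = false} => (ends l.1).map (openGraph (labelledOpen ends zN)).connectedComponentMk)
              (Function.update z' b false))).Reachable X Y) ∧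
        (¬ (openGraph (labelledOpen
              (fun l : {l // zN l = false} => (ends l.1).map (openGraph (labelledOpen ends zN)).connectedComponentMk) z')).Reachable
              ((openGraph (labelledOpen ends zN)).connectedComponentMk a) ((openGraph (labelledOpen ends zN)).connectedComponentMk s) ∧
          ¬ (openGraph (labelledOpen
              (fun l : {l // zN l = false} => (ends l.1).map (openGraph (labelledOpen ends zN)).connectedComponentMk) z')).Reachable
              ((openGraph (labelledOpen ends zN)).connectedComponentMk a) ((openGraph (labelledOpen ends zN)).connectedComponentMk c) ∧
          ¬ (openGraph (labelledOpen
              (fun l : {l // zN l = false} => (ends l.1).map (openGraph (labelledOpen ends zN)).connectedComponentMk) z')).Reachable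
              ((openGraph (labelledOpen ends zN)).connectedComponentMk s) ((openGraph (labelledOpen ends zN)).connectedComponentMk c)) ∧
        (openGraph (labelledOpen
            (fun l : {l // zN l = false} => (ends l.1).map (openGraph (labelledOpen ends zN)).connectedComponentMk)
            (clusterFlip (fun l : {l // zN l = false} => (ends l.1).map (openGraph (labelledOpen ends zN)).connectedComponentMk)
              ((openGraph (labelledOpen ends zN)).connectedComponentMk a) (fun l => !z' l)))).Reachable
          ((openGraph (labelledOpen ends zN)).connectedComponentMk s) ((openGraph (labelledOpen ends zN)).connectedComponentMk c)).card ≤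
      (univ.filter fun z' : {l // zN l = false} → Bool =>
        (∀ b, z' b = true → ∀ X Y,
          (fun l : {l // zN l = false} => (ends l.1).map (openGraph (labelledOpen ends zN)).connectedComponentMk) b = s(X, Y) →
            X ≠ Y ∧ ¬ (openGraph (labelledOpen
              (fun l : {l // zN l = false} => (ends l.1).map (openGraph (labelledOpen ends zN)).connectedComponentMk)
              (Function.update z' b false))).Reachable X Y) ∧
        ((openGraph (labelledOpen
              (fun l : {l // zN l = false} => (ends l.1).map (openGraph (labelledOpen ends zN)).connectedComponentMk) z')).Reachable
              ((openGraph (labelledOpen ends zN)).connectedComponentMk a) ((openGraph (labelledOpen ends zN)).connectedComponentMk s) ∧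
          ¬ (openGraph (labelledOpen
              (fun l : {l // zN l = false} => (ends l.1).map (openGraph (labelledOpen ends zN)).connectedComponentMk) z')).Reachable
              ((openGraph (labelledOpen ends zN)).connectedComponentMk a) ((openGraph (labelledOpen ends zN)).connectedComponentMk c))).card +
      (univ.filter fun z' : {l // zN l = false} → Bool =>
        (∀ b, z' b = true → ∀ X Y,
          (fun l : {l // zN l = false} => (ends l.1).map (openGraph (labelledOpen ends zN)).connectedComponentMk) b = s(X, Y) →
            X ≠ Y ∧ ¬ (openGraph (labelledOpen
              (fun l : {l // zN l = false} => (ends l.1).map (openGraph (labelledOpen ends zN)).connectedComponentMk)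
              (Function.update z' b false))).Reachable X Y) ∧
        ((openGraph (labelledOpen
              (fun l : {l // zN l = false} => (ends l.1).map (openGraph (labelledOpen ends zN)).connectedComponentMk) z')).Reachable
              ((openGraph (labelledOpen ends zN)).connectedComponentMk a) ((openGraph (labelledOpen ends zN)).connectedComponentMk c) ∧
          ¬ (openGraph (labelledOpen
              (fun l : {l // zN l = false} => (ends l.1).map (openGraph (labelledOpen ends zN)).connectedComponentMk) z')).Reachable
              ((openGraph (labelledOpen ends zN)).connectedComponentMk a) ((openGraph (labelledOpen ends zN)).connectedComponentMk s))).card) :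
    (univ.filter fun z : α → Bool =>
        (¬ (openGraph (labelledOpen ends z)).Reachable a s ∧ ¬ (openGraph (labelledOpen ends z)).Reachable a c ∧
          ¬ (openGraph (labelledOpen ends z)).Reachable s c) ∧
        (openGraph (labelledOpen ends (clusterFlip ends a fun l => !z l))).Reachable s c).card ≤
    (univ.filter fun z : α → Bool =>
        (openGraph (labelledOpen ends z)).Reachable a s ∧ ¬ (openGraph (labelledOpen ends z)).Reachable a c).card +
    (univ.filter fun z : α → Bool =>
        (openGraph (labelledOpen ends z)).Reachable a c ∧ ¬ (openGraph (labelledOpen ends z)).Reachable a s).card := by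
  have hfb := card_filter_eq_sum_skeleton ends (fun z : α → Bool => (¬ (openGraph (labelledOpen ends z)).Reachable a s ∧ ¬ (openGraph (labelledOpen ends z)).Reachable a c ∧
      ¬ (openGraph (labelledOpen ends z)).Reachable s c) ∧ (openGraph (labelledOpen ends (clusterFlip ends a fun l => !z l))).Reachable s c)
  have hf1 := card_filter_eq_sum_skeleton ends (fun z : α → Bool => (openGraph (labelledOpen ends z)).Reachable a s ∧ ¬ (openGraph (labelledOpen ends z)).Reachable a c)
  have hf2 := card_filter_eq_sum_skeleton ends (fun z : α → Bool => (openGraph (labelledOpen ends z)).Reachable a c ∧ ¬ (openGraph (labelledOpen ends z)).Reachable a s)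
  rw [hfb, hf1, hf2, ← Finset.sum_add_distrib]
  refine Finset.sum_le_sum fun zN _ => ?_
  by_cases hne : ∃ z₀ : α → Bool,
      (∀ l, zN l = true → z₀ l = true ∧
          ∀ x y, ends l = s(x, y) → (openGraph (labelledOpen ends (Function.update z₀ l false))).Reachable x y) ∧
        (∀ l, zN l = false → z₀ l = true →
          ∀ x y, ends l = s(x, y) → ¬ (openGraph (labelledOpen ends (Function.update z₀ l false))).Reachable x y)
  · calc _ ≤ _ := card_bad_skeleton_le ends a s c zN
      _ ≤ _ := hFOR zN
      _ ≤ _ := Nat.add_le_add (card_forest_sa_quotient_le ends a s c zN hne) (card_forest_sa_quotient_le ends a c s zN hne)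
  · refine le_of_eq_of_le (Finset.card_eq_zero.2 ?_) (Nat.zero_le _)
    rw [Finset.filter_eq_empty_iff]
    intro z _ hz
    exact hne ⟨z, hz.1⟩

end Counting

end ForestFormToFibre

end Summit.CriticalPhenomena.PercolationContinuityZ3.Theorems.ProductFormFibre
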